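import Mathlib
import Literature.NumberTheory.LFunctions.Zhang2022.TypedAppendixB
import Literature.NumberTheory.LFunctions.Zhang2022.AppendixBVarrhoB2
import HarnessLib

/-!
# Zhang (2022), Appendix B, §B.u005: the Euler-product step of (B.2) in its printed (two-constant) shape

Topic `Literature/NumberTheory/LFunctions/Zhang2022` (Landau–Siegel audit tree; verdict-neutral).
Y. Zhang, *Discrete mean estimates and the Landau–Siegel zero*, arXiv:2211.02515v1 (2022)
[Zhang2022LandauSiegel] — **an unrefereed manuscript under adjudication**. The display after (B.2)
(Appendix B p. 107, tex L5274–5279, DAG `Z22:§B.u005`): "the left side [of (B.2)] is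
`≤ (Σ_{q<D⁴}|ϱ_j(q)|/q) ∏_{q<P}(1 + |ϱ_j(q)|/q + O(1/q²)) ≪ α Σ_{q<D⁴} log q/q`" has TWO independent
implied constants (the `O(1/q²)` inside the product and the final `≪`). The cell's typed node
`Typed.AppendixB.StepB_u005 c′` gives both the same name `C`, which makes it unprovable (the product
exceeds `∏_p(1 + C/p²)`, which outgrows `C`; gap row G-d59-2 of the cell). This file PROVES the
display in its faithful two-constant reading, `stepB_u005_two`:

`∃ C₀ C, for D large, ∀ j ∈ {1,2,3}: Σ_{n<⌈P⌉,(n,𝔮)>1}|ϱ_j(n)|/n ≤ (Σ_{q<D⁴}|ϱ_j(q)|/q)·∏_{q<⌈P⌉}(1+|ϱ_j(q)|/q+C₀/q²)`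
`  and (Σ_{q<D⁴}|ϱ_j(q)|/q)·∏_{q<⌈P⌉}(1+|ϱ_j(q)|/q+C₀/q²) ≤ C·α·Σ_{q<D⁴} log q/q`,

with `C₀ = 28` (the `q`-adic tower `Σ_{r≥1}|ϱ_j(q)|/q^r = |ϱ_j(q)|/(q−1)` costs a factor `q/(q−1) ≤ 2`,
absorbed at the prime `2` of the product: `2(1 + a + 4/4) ≤ 1 + a + 28/4`) and
`C = 3(1+5|c′|π)·e^{12π(1+5|c′|π)+28}`. Ingredients: `AppendixBVarrho.sum_filter_not_coprime_le`,
`sum_filter_dvd_le`, the Hall–Tenenbaum inequality `HallTenenbaum.sum_div_le_prod_tsum` in the shape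
`Σ_{n≤X}|ϱ(n)|/n ≤ ∏_{p≤X}(1 + |ϱ(p)|/p + 4/p²)` (`sum_norm_rho_div_le_prod`), Mertens
(`MeanSquareMajorant.sum_prime_div_le`, `MertensBound.sum_inv_prime_mul_pred_le_one`).
No claim about Theorems 1–2 of the source or about Landau–Siegel zeros.
-/

noncomputable section

open Complex Real Finset ArithmeticFunction

namespace Literature.NumberTheory.LFunctions.Zhang2022.AppendixBVarrho

open Literature.NumberTheory.LFunctions.Zhang2022 Skeleton MeanSquareMajorant Typed.AppendixB

/-! ## The Euler-product shape of the full sum -/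

/-- **`Σ_{n≤X} |ϱ_v(n)|/n ≤ ∏_{p≤X}(1 + |ϱ_v(p)|/p + 4/p²)`** (Hall–Tenenbaum (0.4) with the local
series `1 + |ϱ_v(p)|(p⁻¹ + p⁻² + ⋯) = 1 + |ϱ_v(p)|/(p−1) ≤ 1 + |ϱ_v(p)|/p + 4/p²`; the source's
"`∏_{q<P}(1 + |ϱ_j(q)|/q + O(1/q²))`"). [cite: Zhang2022LandauSiegel, Appendix B (proof of (B.2))] -/
theorem sum_norm_rho_div_le_prod (v : ℝ) (X : ℕ) :
    ∑ n ∈ Icc 1 X, ‖rho v n‖ / n ≤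
      ∏ p ∈ Nat.primesLE X, (1 + ‖rho v p‖ / p + 4 / (p : ℝ) ^ 2) := by
  set f : ℕ → ℝ := fun n => ‖rho v n‖ with hf
  have hf1 : f 1 = 1 := by simp [hf, rho_one]
  have hmul : ∀ m n, Nat.Coprime m n → f (m * n) = f m * f n := fun m n hmn => by
    simp only [hf, rho_mul_of_coprime v hmn, norm_mul]
  have hf0 : ∀ n, 0 ≤ f n := fun n => norm_nonneg _
  -- termwise bound of the local series: `f(p^ν)/p^ν ≤ 2 (1/2)^ν`
  have hterm : ∀ p ν : ℕ, p.Prime → f (p ^ ν) / (p : ℝ) ^ ν ≤ 2 * (1 / 2 : ℝ) ^ ν := by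
    intro p ν hp
    have hp2 : (2 : ℝ) ≤ p := by exact_mod_cast hp.two_le
    have hppos : (0 : ℝ) < (p : ℝ) ^ ν := by positivity
    rw [div_le_iff₀ hppos]
    have h1 : (1 : ℝ) ≤ (1 / 2 : ℝ) ^ ν * (p : ℝ) ^ ν := by
      rw [← mul_pow]; exact one_le_pow₀ (by linarith)
    have hfle : f (p ^ ν) ≤ 2 := by
      rcases Nat.eq_zero_or_pos ν with rfl | hν
      · simp [hf1]
      · exact norm_rho_prime_pow_le_two v hp hν.ne'
    nlinarith [hf0 (p ^ ν)]
  have hsum : ∀ p, p.Prime → Summable (fun ν : ℕ => f (p ^ ν) / (p : ℝ) ^ ν) := by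
    intro p hp
    refine Summable.of_nonneg_of_le (fun ν => div_nonneg (hf0 _) (by positivity))
      (fun ν => hterm p ν hp) ?_
    exact (summable_geometric_of_lt_one (by norm_num) (by norm_num)).mul_left 2
  refine (HallTenenbaum.sum_div_le_prod_tsum hf1 hmul hf0 hsum X).trans ?_
  refine prod_le_prod (fun p _ => tsum_nonneg fun ν => div_nonneg (hf0 _) (by positivity)) ?_
  intro p hp
  have hp' := (Nat.mem_primesLE.1 hp).2
  have hp2 : (2 : ℝ) ≤ p := by exact_mod_cast hp'.two_le
  have hp0 : (0 : ℝ) < p := by linarith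
  -- split off `ν = 0, 1`, bound the tail by `Σ_{i} 2/p^{i+2} = 2/(p(p−1)) ≤ 4/p²`
  have hsplit := (hsum p hp').sum_add_tsum_nat_add 2
  have h2 : ∑ i ∈ range 2, f (p ^ i) / (p : ℝ) ^ i = 1 + f p / p := by
    simp [Finset.sum_range_succ, hf1]
  rw [← hsplit, h2]
  have htail_term : ∀ i : ℕ, f (p ^ (i + 2)) / (p : ℝ) ^ (i + 2) ≤ 2 / (p : ℝ) ^ 2 * (1 / (p : ℝ)) ^ i := by
    intro i
    have hle : f (p ^ (i + 2)) ≤ 2 := norm_rho_prime_pow_le_two v hp' (Nat.succ_ne_zero _)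
    rw [div_le_iff₀ (by positivity)]
    have : 2 / (p : ℝ) ^ 2 * (1 / (p : ℝ)) ^ i * (p : ℝ) ^ (i + 2) = 2 := by
      rw [one_div_pow, pow_add]; field_simp
    rw [this]; exact hle
  have hs1 := (summable_nat_add_iff (f := fun ν : ℕ => f (p ^ ν) / (p : ℝ) ^ ν) 2).mpr (hsum p hp')
  have hgeo : Summable (fun i : ℕ => 2 / (p : ℝ) ^ 2 * (1 / (p : ℝ)) ^ i) :=
    (summable_geometric_of_lt_one (by positivity)
      ((div_lt_one hp0).mpr (by linarith))).mul_left _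
  have htail : ∑' i : ℕ, f (p ^ (i + 2)) / (p : ℝ) ^ (i + 2) ≤ 4 / (p : ℝ) ^ 2 := by
    calc ∑' i : ℕ, f (p ^ (i + 2)) / (p : ℝ) ^ (i + 2)
        ≤ ∑' i : ℕ, 2 / (p : ℝ) ^ 2 * (1 / (p : ℝ)) ^ i := Summable.tsum_le_tsum htail_term hs1 hgeo
      _ = 2 / (p : ℝ) ^ 2 * (1 - 1 / (p : ℝ))⁻¹ := by
          rw [tsum_mul_left, tsum_geometric_of_lt_one (by positivity) ((div_lt_one hp0).mpr (by linarith))]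
      _ ≤ 2 / (p : ℝ) ^ 2 * 2 := by
          refine mul_le_mul_of_nonneg_left ?_ (by positivity)
          rw [inv_le_comm₀ (by rw [sub_pos, div_lt_one hp0]; linarith) (by norm_num)]
          have : 1 / (p : ℝ) ≤ 1 / 2 := one_div_le_one_div_of_le (by norm_num) hp2
          linarith
      _ = 4 / (p : ℝ) ^ 2 := by ring
  have : f p = ‖rho v p‖ := rfl
  rw [this] at *
  linarith

/-! ## §B.u005 in the two-constant reading -/

/-- **§B.u005, faithful reading** (the display after (B.2), p. 107): there are `C₀, C` such that for
`D` large and `j ∈ {1,2,3}`,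
`Σ_{n<⌈P⌉,(n,𝔮)>1}|ϱ_j(n)|/n ≤ (Σ_{q<D⁴}|ϱ_j(q)|/q)·∏_{q<⌈P⌉}(1 + |ϱ_j(q)|/q + C₀/q²)` and
`(Σ_{q<D⁴}|ϱ_j(q)|/q)·∏_{q<⌈P⌉}(1 + |ϱ_j(q)|/q + C₀/q²) ≤ C·α·Σ_{q<D⁴} log q/q`
(sums/products over primes; `ϱ_j = Typed.AppendixB.varrhoJ`; `C₀ = 28`,
`C = 3(1+5|c′|π)e^{12π(1+5|c′|π)+28}`). This is the cell's node `StepB_u005 c′` with its two implied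
constants kept distinct (the single-constant typing is not provable; gap row G-d59-2).
[cite: Zhang2022LandauSiegel, Appendix B p.107 (display after (B.2))] -/
theorem stepB_u005_two (c' : ℝ) : ∃ C₀ C : ℝ, ForAllLarge fun D _ _ =>
    ∀ j ∈ ({1, 2, 3} : Finset ℕ),
      (∑ n ∈ (Finset.Ico 1 ⌈bigP D⌉₊).filter (fun n => ¬ Nat.Coprime n (frakq D)),
            ‖varrhoJ c' D j n‖ / (n : ℝ) ≤
          (∑ q ∈ (Finset.range (D ^ 4)).filter Nat.Prime, ‖varrhoJ c' D j q‖ / q) *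
            ∏ q ∈ (Finset.range ⌈bigP D⌉₊).filter Nat.Prime,
              (1 + ‖varrhoJ c' D j q‖ / q + C₀ / (q : ℝ) ^ 2)) ∧
      ((∑ q ∈ (Finset.range (D ^ 4)).filter Nat.Prime, ‖varrhoJ c' D j q‖ / q) *
            ∏ q ∈ (Finset.range ⌈bigP D⌉₊).filter Nat.Prime,
              (1 + ‖varrhoJ c' D j q‖ / q + C₀ / (q : ℝ) ^ 2) ≤
          C * alpha D * ∑ q ∈ (Finset.range (D ^ 4)).filter Nat.Prime, Real.log q / q) := by
  set M₀ : ℝ := 1 + 5 * |c'| * Real.pi with hM₀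
  have hM₀0 : 0 ≤ M₀ := by positivity
  refine ⟨28, 3 * M₀ * Real.exp (12 * Real.pi * M₀ + 28), 3, fun D _ _ hD _ _ j _ => ?_⟩
  obtain ⟨hℓ, hα, hαℓ, hα0⟩ := params_of_three_le hD
  obtain ⟨v, hv, hvle⟩ := betaJ_eq_ofReal_mul_I c' D j
  have hM : 1 + 5 * |c'| * alpha D * ell D ≤ M₀ := by rw [hM₀]; nlinarith [abs_nonneg c']
  have hv' : |v| ≤ 3 * alpha D * M₀ := hvle.trans (by gcongr)
  -- the typed `ϱ_j` is `rho v`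
  have hJ : ∀ n : ℕ, varrhoJ c' D j n = rho v n := fun n => by
    show ∑ d ∈ n.divisors, (ArithmeticFunction.moebius d : ℂ) * (d : ℂ) ^ betaJ c' D j = rho v n
    rw [hv]; rfl
  simp only [hJ]
  -- ranges: `[1, ⌈P⌉) = [1, X]`, primes `< ⌈P⌉` = primes `≤ X`, `X = ⌈P⌉ − 1 ≥ 2`
  set X : ℕ := ⌈bigP D⌉₊ - 1 with hXdef
  have hP : Real.exp 1 ≤ bigP D := by
    unfold bigP; exact Real.exp_le_exp.mpr (by nlinarith [one_le_pow₀ (n := 9) hℓ])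
  have hP2 : (2 : ℝ) < bigP D := lt_of_lt_of_le (by linarith [Real.exp_one_gt_d9]) hP
  have hX2 : 2 ≤ X := by
    have : 2 < ⌈bigP D⌉₊ := Nat.lt_ceil.mpr (by exact_mod_cast hP2)
    omega
  have hIco : Finset.Ico 1 ⌈bigP D⌉₊ = Icc 1 X := by
    ext n; simp only [Finset.mem_Ico, mem_Icc, hXdef]; omega
  have hprimes : (Finset.range ⌈bigP D⌉₊).filter Nat.Prime = Nat.primesLE X := by
    rw [hXdef, ← Nat.primesBelow_eq_primesLE_sub_one]; rfl
  rw [hIco, hprimes]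
  set S := (Finset.range (D ^ 4)).filter Nat.Prime with hSdef
  have hS : ∀ q ∈ S, q.Prime := fun q hq => (mem_filter.mp hq).2
  have hfrakq : frakq D = ∏ q ∈ S, q := rfl
  set F := ∑ n ∈ Icc 1 X, ‖rho v n‖ / n with hFdef
  have hF0 : 0 ≤ F := sum_nonneg fun n _ => by positivity
  set A := ∑ q ∈ S, ‖rho v q‖ / q with hAdef
  have hA0 : 0 ≤ A := sum_nonneg fun q _ => by positivity
  set PF := ∏ p ∈ Nat.primesLE X, (1 + ‖rho v p‖ / p + 4 / (p : ℝ) ^ 2) with hPF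
  set PP := ∏ p ∈ Nat.primesLE X, (1 + ‖rho v p‖ / p + 28 / (p : ℝ) ^ 2) with hPPdef
  -- (i) `S_bad ≤ 2 F A`
  have hbad : ∑ n ∈ (Icc 1 X).filter (fun n => ¬ Nat.Coprime n (frakq D)), ‖rho v n‖ / n ≤
      2 * F * A := by
    rw [hfrakq]
    calc ∑ n ∈ (Icc 1 X).filter (fun n => ¬ Nat.Coprime n (∏ q ∈ S, q)), ‖rho v n‖ / n
        ≤ ∑ q ∈ S, ∑ n ∈ (Icc 1 X).filter (fun n => q ∣ n), ‖rho v n‖ / n :=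
          sum_filter_not_coprime_le hS (fun n => by positivity) _
      _ ≤ ∑ q ∈ S, 2 * ‖rho v q‖ / q * F := sum_le_sum fun q hq => sum_filter_dvd_le v (hS q hq) X
      _ = 2 * F * A := by rw [hAdef, mul_sum]; exact sum_congr rfl fun q _ => by ring
  -- (ii) `F ≤ PF` and `2 PF ≤ PP`
  have hFP : F ≤ PF := sum_norm_rho_div_le_prod v X
  have h2mem : 2 ∈ Nat.primesLE X := Nat.mem_primesLE.mpr ⟨hX2, Nat.prime_two⟩
  have hfac_nonneg : ∀ p ∈ Nat.primesLE X, ∀ c : ℝ, 0 ≤ c → 0 ≤ 1 + ‖rho v p‖ / p + c / (p : ℝ) ^ 2 :=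
    fun p _ c hc => by positivity
  have h2P : 2 * PF ≤ PP := by
    rw [hPF, hPPdef, ← mul_prod_erase _ _ h2mem, ← mul_prod_erase (Nat.primesLE X) _ h2mem, ← mul_assoc]
    have ha : ‖rho v 2‖ / 2 ≤ 1 := by
      rw [div_le_one (by norm_num)]
      simpa using norm_rho_prime_pow_le_two v Nat.prime_two one_ne_zero
    refine mul_le_mul ?_ (prod_le_prod (fun p hp => hfac_nonneg p (mem_of_mem_erase hp) 4 (by norm_num))
      fun p _ => by gcongr; norm_num) (prod_nonneg fun p hp => hfac_nonneg p (mem_of_mem_erase hp) 4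
        (by norm_num)) (hfac_nonneg 2 h2mem 28 (by norm_num))
    push_cast
    nlinarith [norm_nonneg (rho v 2)]
  -- (iii) `PP ≤ e^{12πM₀ + 28}`
  have hXP : (X : ℝ) ≤ bigP D := by
    have h1 : ((⌈bigP D⌉₊ - 1 : ℕ) : ℝ) = (⌈bigP D⌉₊ : ℝ) - 1 := by
      rw [Nat.cast_sub (by omega), Nat.cast_one]
    rw [hXdef, h1]; linarith [Nat.ceil_lt_add_one (show (0 : ℝ) ≤ bigP D by linarith)]
  have hlog4X : |v| * (Real.log X + Real.log 4) ≤ 12 * Real.pi * M₀ := by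
    have hlogX : Real.log X ≤ ell D ^ 9 := by
      calc Real.log X ≤ Real.log (bigP D) := Real.log_le_log (by exact_mod_cast (show 0 < X by omega)) hXP
        _ = ell D ^ 9 := by unfold bigP; rw [Real.log_exp]
    have h4 : Real.log 4 ≤ 2 := by
      have h2 : Real.log 4 = 2 * Real.log 2 := by
        rw [show (4 : ℝ) = 2 ^ 2 by norm_num, Real.log_pow]; norm_num
      rw [h2]; linarith [Real.log_two_lt_d9]
    have hℓ9 : 1 ≤ ell D ^ 9 := one_le_pow₀ hℓ
    calc |v| * (Real.log X + Real.log 4) ≤ 3 * alpha D * M₀ * (4 * ell D ^ 9) :=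
          mul_le_mul hv' (by linarith) (by positivity) (by positivity)
      _ = 12 * Real.pi * M₀ := by rw [hα]; field_simp; ring
  have hPexp : PP ≤ Real.exp (12 * Real.pi * M₀ + 28) := by
    have h1 : PP ≤ Real.exp (∑ p ∈ Nat.primesLE X, (‖rho v p‖ / p + 28 / (p : ℝ) ^ 2)) := by
      rw [Real.exp_sum]
      refine prod_le_prod (fun p hp => hfac_nonneg p hp 28 (by norm_num)) fun p _ => ?_
      have := Real.add_one_le_exp (‖rho v p‖ / p + 28 / (p : ℝ) ^ 2)
      linarith
    refine h1.trans (Real.exp_le_exp.mpr ?_)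
    rw [sum_add_distrib]
    have hs1 : ∑ p ∈ Nat.primesLE X, ‖rho v p‖ / p ≤ |v| * (Real.log X + Real.log 4) := by
      have := sum_prime_div_le (f := fun n => ‖rho v n‖) (a := 0) (K := |v|) (abs_nonneg v)
        (fun p hp => by simpa using norm_rho_prime_pow_le v hp one_ne_zero) hX2
      simpa using this
    have hs2 : ∑ p ∈ Nat.primesLE X, 28 / (p : ℝ) ^ 2 ≤ 28 := by
      calc ∑ p ∈ Nat.primesLE X, 28 / (p : ℝ) ^ 2 = 28 * ∑ p ∈ Nat.primesLE X, 1 / (p : ℝ) ^ 2 := by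
            rw [mul_sum]; exact sum_congr rfl fun p _ => by ring
        _ ≤ 28 * ∑ p ∈ Nat.primesLE X, (1 : ℝ) / (p * (p - 1)) := by
            refine mul_le_mul_of_nonneg_left (sum_le_sum fun p hp => ?_) (by norm_num)
            have hp2 : (2 : ℝ) ≤ p := by exact_mod_cast (Nat.mem_primesLE.1 hp).2.two_le
            exact one_div_le_one_div_of_le (by nlinarith) (by nlinarith)
        _ ≤ 28 * 1 := mul_le_mul_of_nonneg_left (MertensBound.sum_inv_prime_mul_pred_le_one X) (by norm_num)
        _ = 28 := by ring
    linarith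
  -- (iv) `A ≤ 3αM₀ Σ log q/q`
  have hAle : A ≤ 3 * alpha D * M₀ * ∑ q ∈ S, Real.log q / q := by
    rw [hAdef, mul_sum]
    refine sum_le_sum fun q hq => ?_
    have h := norm_rho_prime_pow_le v (hS q hq) one_ne_zero
    rw [pow_one] at h
    have hq0 : (0 : ℝ) < q := by exact_mod_cast (hS q hq).pos
    calc ‖rho v q‖ / q ≤ |v| * Real.log q / q := div_le_div_of_nonneg_right h hq0.le
      _ ≤ 3 * alpha D * M₀ * Real.log q / q := by
          gcongr
      _ = 3 * alpha D * M₀ * (Real.log q / q) := by ring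
  have hS0 : 0 ≤ ∑ q ∈ S, Real.log q / q := sum_nonneg fun q hq =>
    div_nonneg (Real.log_nonneg (by exact_mod_cast (hS q hq).one_lt.le)) (Nat.cast_nonneg _)
  have hPP0 : 0 ≤ PP := prod_nonneg fun p hp => hfac_nonneg p hp 28 (by norm_num)
  constructor
  · calc ∑ n ∈ (Icc 1 X).filter (fun n => ¬ Nat.Coprime n (frakq D)), ‖rho v n‖ / n
        ≤ 2 * F * A := hbad
      _ ≤ A * PP := by
          have h1 : 2 * F ≤ PP := by linarith
          calc 2 * F * A = A * (2 * F) := by ring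
            _ ≤ A * PP := mul_le_mul_of_nonneg_left h1 hA0
  · calc A * PP ≤ (3 * alpha D * M₀ * ∑ q ∈ S, Real.log q / q) * Real.exp (12 * Real.pi * M₀ + 28) :=
          mul_le_mul hAle hPexp hPP0
            (mul_nonneg (mul_nonneg (mul_nonneg (by norm_num) hα0) hM₀0) hS0)
      _ = 3 * M₀ * Real.exp (12 * Real.pi * M₀ + 28) * alpha D * ∑ q ∈ S, Real.log q / q := by ring

end Literature.NumberTheory.LFunctions.Zhang2022.AppendixBVarrho
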